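import Literature.Algebra.EuclideanLattices.RegevQuantumPartStates
import Literature.Computability.QuantumComplexity.RevArith
import HarnessLib

/-!
# Regev 2009, Lemma 3.12 (machine form): the product of the one-dimensional Gaussian states is the box Gaussian

Topic `Algebra/EuclideanLattices` (family `pqc`), sequel of `RegevQuantumPartStates.lean` and
`QuantumComplexity/GaussianCellsPoint.lean`. Regev's sampler prepares the `n`-dimensional Gaussian
state coordinate by coordinate ("Repeating the procedure described above `n` times creates a system
whose state is the `n`-fold tensor product … which can be written as `Σ_{x ∈ {−√n r,…,√n r}ⁿ} ρ_{√2r}(x)|x⟩`",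
Regev 2009, Lemma 3.12, proof). In the tree's model the `n` coordinate registers are disjoint blocks
`E i : Fin b ↪ Fin W` of the machine's register, each holding the one-dimensional point-Gaussian state
`ptQsample ℓ c ws x₀` (the normalised `Σ_u e^{-cu²/2}|u⟩` on the `ℓ` data wires `ws` of the block, base
content `x₀`), and the whole is the product state `prodState E (fun _ => ptQsample ℓ c ws x₀) cW` of
`CircuitEmbedding.lean`. This file identifies it with the box Gaussian of the analysis
(`QPart.embed Box (ρ/Z) lab₀` of `RegevQuantumPartStates.lean`, the `ε₁`-reference state of
`QPart.law_bound`): with `c = 2π/D²`,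

* `boxPt D Y = (u(Y i)/D)ᵢ ∈ ℝⁿ` (`u = cellPt`, injective: `binVal_eq_ofBits`, `cellPt_injective`),
  `boxSet n ℓ D` (the box: all block contents), `boxLab E ws x₀ cW Y` (the register label of the block
  contents) and `boxLab₀` (the label map on `ℝⁿ`);
* `prod_normalize_ptAmpVec` — `Πᵢ p̂t(Y i) = ρ(boxPt Y)/Z` (`Πᵢ e^{-cuᵢ²/2} = e^{-π‖u/D‖²}`,
  `Z = ‖pt‖ⁿ` by `zBox_boxSet`);
* **`QPart.prodState_ptQsample_eq_embed`** — `⨂ᵢ ptQsample = Z⁻¹ Σ_{x ∈ Box} ρ(x) |lab₀ x⟩`.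

Everything here is proved; definitions have bodies; no named fact is introduced.

## References

* O. Regev, *On lattices, learning with errors, random linear codes, and cryptography*, J. ACM 56
  (2009), art. 34; arXiv:2401.03703, Lemma 3.12 (proof) [Regev2009].
* M. A. Nielsen, I. L. Chuang, *Quantum Computation and Quantum Information*, CUP 2010, §2.1.7
  [NielsenChuang2010].
-/

noncomputable section

open Module Metric Finset _root_.Matrix
open scoped Real InnerProductSpace ENNReal

namespace Literature.Algebra.EuclideanLattices

namespace Regev2009

namespace QPart

open Literature.Computability.Cryptography Literature.Computability.QuantumComplexity
  Literature.Computability.QuantumComplexity.QState Literature.Computability.QuantumComplexity.GaussianCells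
  Literature.Computability.QuantumComplexity.GroverRudolph

variable {n ℓ b W : ℕ}

/-! ### The binary value is injective -/

/-- `binVal` is `Nat.ofBits` of the reversed bits. [folklore] -/
theorem binVal_eq_ofBits (y : Fin ℓ → Bool) : binVal y = Nat.ofBits (fun j : Fin ℓ => y (Fin.rev j)) := by
  rw [ofBits_eq_sum, binVal, hiVal, ← Equiv.sum_comp Fin.revPerm]
  refine sum_congr rfl fun j _ => ?_
  simp only [Fin.revPerm_apply, Fin.val_rev]
  have hj : ℓ - ((j : ℕ) + 1) < ℓ := by omega
  cases y (Fin.rev j) <;> simp [hj]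
  omega

/-- `binVal` is injective. [folklore] -/
theorem binVal_injective : Function.Injective (binVal : (Fin ℓ → Bool) → ℕ) := fun y y' h => by
  rw [binVal_eq_ofBits, binVal_eq_ofBits] at h
  have h1 : ∀ (g : Fin ℓ → Bool) (i : Fin ℓ), (Nat.ofBits g).testBit (Fin.rev i) = g (Fin.rev i) := fun g i => by
    rw [Nat.testBit_ofBits_lt g _ (Fin.rev i).2]
  funext i
  have h2 := congrArg (fun v => Nat.testBit v (Fin.rev i)) h
  rw [h1, h1, Fin.rev_rev] at h2
  exact h2

/-- `cellPt` is injective. [folklore] -/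
theorem cellPt_injective : Function.Injective (cellPt ℓ) := fun y y' h => by
  unfold cellPt at h
  exact binVal_injective (by exact_mod_cast sub_left_injective h)

/-! ### The box points and the box -/

/-- **The point of the block contents**: `(u(Y i)/D)ᵢ ∈ ℝⁿ`. [cite: Regev2009, Lemma 3.12 (proof: the rescaling `L ⊆ ℤⁿ`)] -/
def boxPt (D : ℝ) (Y : Fin n → Fin ℓ → Bool) : EuclideanSpace ℝ (Fin n) := WithLp.toLp 2 fun i => (cellPt ℓ (Y i) : ℝ) / D

/-- Coordinates of `boxPt`. [folklore] -/
@[simp] theorem boxPt_apply (D : ℝ) (Y : Fin n → Fin ℓ → Bool) (i : Fin n) : boxPt D Y i = (cellPt ℓ (Y i) : ℝ) / D := rfl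

/-- `boxPt` is injective (`D ≠ 0`). [folklore] -/
theorem boxPt_injective {D : ℝ} (hD : D ≠ 0) : Function.Injective (boxPt (n := n) (ℓ := ℓ) D) := fun Y Y' h => by
  funext i
  have hi := congrArg (fun x : EuclideanSpace ℝ (Fin n) => x i) h
  simp only [boxPt_apply] at hi
  rw [div_left_inj' hD] at hi
  exact cellPt_injective (by exact_mod_cast hi)

/-- **The box**: the points of all block contents. [cite: Regev2009, Lemma 3.12 (proof: `{−√n r,…,√n r}ⁿ`)] -/
def boxSet (n ℓ : ℕ) (D : ℝ) : Finset (EuclideanSpace ℝ (Fin n)) := univ.image (boxPt (n := n) (ℓ := ℓ) D)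

/-- The box is nonempty. [folklore] -/
theorem boxSet_nonempty (n ℓ : ℕ) (D : ℝ) : (boxSet n ℓ D).Nonempty :=
  ⟨boxPt D fun _ _ => false, mem_image_of_mem _ (mem_univ _)⟩

/-! ### The register labels of the block contents -/

section Labels

variable (E : Fin n → (Fin b ↪ Fin W)) (ws : Fin ℓ ↪ Fin b) (x₀ : QReg b) (cW : QReg W)

/-- **The label of the block contents `Y`**: block `i` holds `x₀[ws ↦ Y i]`, the other wires hold `cW`.
[cite: NielsenChuang2010, §2.1.7] -/
def boxLab (Y : Fin n → Fin ℓ → Bool) : QReg W := fun q =>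
  if h : ∃ p : Fin n × Fin b, E p.1 p.2 = q then writeY ws x₀ (Y h.choose.1) h.choose.2 else cW q

/-- **The label map on `ℝⁿ`** (decoding the block contents of a box point). [folklore] -/
def boxLab₀ (D : ℝ) (x : EuclideanSpace ℝ (Fin n)) : QReg W :=
  if h : ∃ Y : Fin n → Fin ℓ → Bool, boxPt D Y = x then boxLab E ws x₀ cW h.choose else cW

variable {E}
variable (hE : BlockDisjoint E)
include hE

/-- Distinct block positions are distinct wires. [folklore] -/
theorem blocks_inj {i i' : Fin n} {j j' : Fin b} (h : E i j = E i' j') : i = i' ∧ j = j' := by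
  by_cases hii : i = i'
  · subst hii; exact ⟨rfl, (E i).injective h⟩
  · exact absurd (Set.disjoint_left.1 (hE i i' hii) ⟨j, rfl⟩) (fun hn => hn ⟨j', h.symm⟩)

/-- On block `i`, the label is the written block content. [folklore] -/
theorem boxLab_apply_block (Y : Fin n → Fin ℓ → Bool) (i : Fin n) (j : Fin b) :
    boxLab E ws x₀ cW Y (E i j) = writeY ws x₀ (Y i) j := by
  unfold boxLab
  have h : ∃ p : Fin n × Fin b, E p.1 p.2 = E i j := ⟨(i, j), rfl⟩
  rw [dif_pos h]
  obtain ⟨h1, h2⟩ := blocks_inj hE h.choose_spec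
  rw [h1, h2]

omit hE in
/-- Off the blocks, the label is `cW`. [folklore] -/
theorem boxLab_apply_off (Y : Fin n → Fin ℓ → Bool) {q : Fin W} (hq : OffBlocks E q) : boxLab E ws x₀ cW Y q = cW q := by
  unfold boxLab
  rw [dif_neg]
  rintro ⟨p, hp⟩
  exact hq p.1 ⟨p.2, hp⟩

/-- The restriction of the label to block `i`. [folklore] -/
theorem boxLab_comp (Y : Fin n → Fin ℓ → Bool) (i : Fin n) : boxLab E ws x₀ cW Y ∘ E i = writeY ws x₀ (Y i) := by
  funext j; exact boxLab_apply_block ws x₀ cW hE Y i j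

/-- The label is injective in the block contents. [folklore] -/
theorem boxLab_injective : Function.Injective (boxLab E ws x₀ cW) := fun Y Y' h => by
  funext i
  have := congrArg (· ∘ E i) h
  simp only [boxLab_comp ws x₀ cW hE] at this
  exact writeY_injective ws x₀ this

omit hE in
/-- On a box point the label map is the label of its block contents. [folklore] -/
theorem boxLab₀_boxPt {D : ℝ} (hD : D ≠ 0) (Y : Fin n → Fin ℓ → Bool) :
    boxLab₀ E ws x₀ cW D (boxPt D Y) = boxLab E ws x₀ cW Y := by
  unfold boxLab₀
  have h : ∃ Y' : Fin n → Fin ℓ → Bool, boxPt D Y' = boxPt D Y := ⟨Y, rfl⟩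
  rw [dif_pos h, boxPt_injective hD h.choose_spec]

end Labels

/-! ### The amplitudes -/

/-- The one-dimensional state on a written label and off the written labels. [folklore] -/
theorem ptQsample_apply (c : ℝ) (ws : Fin ℓ ↪ Fin b) (x₀ : QReg b) (v : QReg b) :
    ptQsample ℓ c ws x₀ v = if h : ∃ y, writeY ws x₀ y = v then normalize (ptAmpVec ℓ c) h.choose else 0 := by
  classical
  unfold ptQsample
  rw [Finset.sum_apply]
  simp only [Pi.smul_apply, basisState_apply, smul_eq_mul, mul_ite, mul_one, mul_zero]
  split_ifs with h
  · rw [Finset.sum_eq_single h.choose]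
    · rw [if_pos h.choose_spec.symm]
    · intro y _ hy
      rw [if_neg]
      intro e; apply hy
      exact writeY_injective ws x₀ (by rw [← e, h.choose_spec])
    · simp
  · exact Finset.sum_eq_zero fun y _ => if_neg fun e => h ⟨y, e.symm⟩

/-- The one-dimensional state on a written label. [folklore] -/
theorem ptQsample_writeY (c : ℝ) (ws : Fin ℓ ↪ Fin b) (x₀ : QReg b) (y : Fin ℓ → Bool) :
    ptQsample ℓ c ws x₀ (writeY ws x₀ y) = normalize (ptAmpVec ℓ c) y := by
  rw [ptQsample_apply]
  have h : ∃ y', writeY ws x₀ y' = writeY ws x₀ y := ⟨y, rfl⟩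
  rw [dif_pos h, writeY_injective ws x₀ h.choose_spec]

/-- `‖pt‖² = Σ_y e^{-c u(y)²}`. [folklore] -/
theorem l2_ptAmpVec_sq (ℓ : ℕ) (c : ℝ) : l2 (ptAmpVec ℓ c) ^ 2 = ∑ y : Fin ℓ → Bool, Real.exp (-(c * (cellPt ℓ y : ℝ) ^ 2)) := by
  rw [l2_sq]
  refine sum_congr rfl fun y _ => ?_
  rw [ptAmpVec, Complex.norm_real, Real.norm_eq_abs, sq_abs, ptAmp_sq]

/-- **`ρ(boxPt Y) = Πᵢ e^{-cu(Y i)²/2}`** for `c = 2π/D²`. [cite: Regev2009, Lemma 3.12 (proof)] -/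
theorem gaussianFunction_boxPt {D c : ℝ} (hD : 0 < D) (hc : c = 2 * π / D ^ 2) (Y : Fin n → Fin ℓ → Bool) :
    gaussianFunction 1 (boxPt D Y) = ∏ i, ptAmp c (cellPt ℓ (Y i)) := by
  unfold gaussianFunction ptAmp
  rw [← Real.exp_sum, one_pow, div_one, EuclideanSpace.real_norm_sq_eq, mul_sum]
  congr 1
  refine sum_congr rfl fun i _ => ?_
  have hco : (boxPt D Y) i = (cellPt ℓ (Y i) : ℝ) / D := rfl
  rw [hco, hc, div_pow]
  field_simp

/-- **`Z = ‖pt‖ⁿ`**: the box norm is the `n`-th power of the one-dimensional norm.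
[cite: Regev2009, Lemma 3.12 (proof: "the n-fold tensor product")] -/
theorem zBox_boxSet {D c : ℝ} (hD : 0 < D) (hc : c = 2 * π / D ^ 2) :
    zBox (boxSet n ℓ D) = l2 (ptAmpVec ℓ c) ^ n := by
  have hsq : zBox (boxSet n ℓ D) ^ 2 = (l2 (ptAmpVec ℓ c) ^ n) ^ 2 := by
    rw [zBox_sq, boxSet, sum_image fun Y _ Y' _ h => boxPt_injective hD.ne' h]
    have hsum : ∀ Y : Fin n → Fin ℓ → Bool, gaussianFunction 1 (boxPt D Y) ^ 2 = ∏ i, Real.exp (-(c * (cellPt ℓ (Y i) : ℝ) ^ 2)) := by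
      intro Y
      rw [gaussianFunction_boxPt hD hc, ← Finset.prod_pow]
      exact Finset.prod_congr rfl fun i _ => ptAmp_sq c _
    simp_rw [hsum]
    rw [← Fintype.prod_sum fun (_ : Fin n) (y : Fin ℓ → Bool) => Real.exp (-(c * (cellPt ℓ y : ℝ) ^ 2)), Finset.prod_const,
      card_univ, Fintype.card_fin, ← l2_ptAmpVec_sq, ← pow_mul, ← pow_mul, mul_comm]
  exact (pow_left_inj₀ (Real.sqrt_nonneg _) (pow_nonneg (l2_nonneg _) _) two_ne_zero).1 hsq

/-- **`Πᵢ p̂t(Y i) = ρ(boxPt Y)/Z`**. [cite: Regev2009, Lemma 3.12 (proof)] -/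
theorem prod_normalize_ptAmpVec {D c : ℝ} (hD : 0 < D) (hc : c = 2 * π / D ^ 2) (Y : Fin n → Fin ℓ → Bool) :
    ∏ i, normalize (ptAmpVec ℓ c) (Y i) = (((gaussianFunction 1 (boxPt D Y) / zBox (boxSet n ℓ D) : ℝ)) : ℂ) := by
  have hterm : ∀ y : Fin ℓ → Bool, normalize (ptAmpVec ℓ c) y = ((((l2 (ptAmpVec ℓ c))⁻¹ * ptAmp c (cellPt ℓ y) : ℝ)) : ℂ) := by
    intro y
    rw [QState.normalize, Pi.smul_apply, ptAmpVec, Complex.real_smul, Complex.ofReal_mul]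
  simp_rw [hterm]
  rw [← Complex.ofReal_prod, prod_mul_distrib, prod_const, card_univ, Fintype.card_fin, ← gaussianFunction_boxPt hD hc,
    zBox_boxSet hD hc, inv_pow, div_eq_inv_mul]

/-! ### The product state is the box Gaussian -/

/-- **Regev 2009, Lemma 3.12 (machine form): the product of the one-dimensional point-Gaussian states
on disjoint blocks is the box Gaussian** `Z⁻¹ Σ_{x ∈ Box} ρ(x) |lab₀ x⟩` (`c = 2π/D²`).
[cite: Regev2009, Lemma 3.12 (proof)] [cite: NielsenChuang2010, §2.1.7] -/
theorem prodState_ptQsample_eq_embed {E : Fin n → (Fin b ↪ Fin W)} (hE : BlockDisjoint E) (ws : Fin ℓ ↪ Fin b) (x₀ : QReg b)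
    (cW : QReg W) {D c : ℝ} (hD : 0 < D) (hc : c = 2 * π / D ^ 2) :
    prodState E (fun _ => ptQsample ℓ c ws x₀) cW =
      embed (boxSet n ℓ D) (fun x => (((gaussianFunction 1 x / zBox (boxSet n ℓ D) : ℝ)) : ℂ)) (boxLab₀ E ws x₀ cW D) := by
  classical
  -- the embedded side as a sum over block contents
  have hR : embed (boxSet n ℓ D) (fun x => (((gaussianFunction 1 x / zBox (boxSet n ℓ D) : ℝ)) : ℂ)) (boxLab₀ E ws x₀ cW D) =
      ∑ Y : Fin n → Fin ℓ → Bool, (∏ i, normalize (ptAmpVec ℓ c) (Y i)) • basisState (boxLab E ws x₀ cW Y) := by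
    have hsumBox : ∀ G : EuclideanSpace ℝ (Fin n) → QReg W → ℂ, ∑ x ∈ boxSet n ℓ D, G x = ∑ Y : Fin n → Fin ℓ → Bool, G (boxPt D Y) := by
      intro G; unfold boxSet; rw [sum_image fun Y _ Y' _ h => boxPt_injective hD.ne' h]
    unfold embed
    rw [hsumBox]
    refine sum_congr rfl fun Y _ => ?_
    rw [boxLab₀_boxPt ws x₀ cW hD.ne', prod_normalize_ptAmpVec hD hc]
  rw [hR]
  funext z
  rw [prodState_apply, Finset.sum_apply]
  simp only [Pi.smul_apply, basisState_apply, smul_eq_mul, mul_ite, mul_one, mul_zero]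
  by_cases hz : ∃ Y, boxLab E ws x₀ cW Y = z
  · -- `z` is the label of the block contents `Y`
    obtain ⟨Y, rfl⟩ := hz
    rw [Finset.sum_eq_single Y]
    · rw [if_pos rfl, if_pos fun w hw => boxLab_apply_off ws x₀ cW Y hw, one_mul]
      refine prod_congr rfl fun i _ => ?_
      rw [boxLab_comp ws x₀ cW hE, ptQsample_writeY]
    · intro Y' _ hY'
      rw [if_neg]
      intro e
      exact hY' (boxLab_injective ws x₀ cW hE e).symm
    · simp
  · -- `z` is no label: both sides vanish
    rw [Finset.sum_eq_zero fun Y _ => if_neg fun e => hz ⟨Y, e.symm⟩]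
    by_cases hoff : ∀ w, OffBlocks E w → z w = cW w
    · rw [if_pos hoff, one_mul]
      -- some block content is not a written label
      have hblk : ∃ i, ¬ ∃ y, writeY ws x₀ y = z ∘ E i := by
        by_contra hall
        push Not at hall
        choose y hy using hall
        apply hz
        refine ⟨y, funext fun q => ?_⟩
        by_cases hq : ∃ p : Fin n × Fin b, E p.1 p.2 = q
        · obtain ⟨⟨i, j⟩, rfl⟩ := hq
          rw [boxLab_apply_block ws x₀ cW hE]
          exact congrFun (hy i) j
        · have hq' : OffBlocks E q := fun i ⟨j, hj⟩ => hq ⟨(i, j), hj⟩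
          rw [boxLab_apply_off ws x₀ cW y hq', hoff q hq']
      obtain ⟨i, hi⟩ := hblk
      apply Finset.prod_eq_zero (mem_univ i)
      rw [ptQsample_apply, dif_neg hi]
    · rw [if_neg hoff, zero_mul]

end QPart

end Regev2009

end Literature.Algebra.EuclideanLattices
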